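import Mathlib
import HarnessLib
import Literature.MathematicalPhysics.QuantumFieldTheory.WilsonPlaquetteWeakCouplingFloorSU2
import Literature.Barriers.QuantumFields.CenterSymmetryBreakingByQuarks
import Summits.Ventures.LatticeQCDFlow.Scaling.AutoregressiveGaugeKLExtensiveAllPlanes

/-!
# LatticeQCDFlow / Scaling — THE VOLUME LAW WITH EXPLICIT CONSTANTS FOR `SU(2)`, ALL ORIENTATIONS: in every
# generation order, an endpoint-blind autoregressive model of `SU(2)` lattice gauge theory (`d ≥ 2`,
# `K = (d−1)β ≥ 2`, `9 + 2 log K ≤ K`) has training loss `≥ (d·L^d/4)·(1 − (9 + 2 log K)/K)²/2` and drives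
# an exact sampler with `τ_int(sign) ≥ exp((d·L^d/4)·(1 − (9 + 2 log K)/K)²/2) − ½`

HONEST FRAMING: exact (Metropolis-corrected) sampling algorithms for lattice gauge theory;
figures of merit are autocorrelation/cost numbers at stated couplings and volumes; no
continuum-physics claim.

Venture `LatticeQCDFlow` (cell pub-lqcd), topic `Scaling`, FANOUT row 30 (lean-1, GEN-21) — OUR WORK on
THEORY-2.md §4 row C5: the `SU(2)` instance of `Scaling/AutoregressiveGaugeKLExtensiveAllPlanes` (the
volume law with any common plaquette-mean floor `w`) with the tree's EXPLICIT volume-uniform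
weak-coupling plaquette floor for `SU(2)` (`Literature/…/WilsonPlaquetteWeakCouplingFloorSU2.wilsonExpectation_plaquette_ge_su2`:
`⟨½ Re tr U_p⟩_{Λ_L,β} ≥ 1 − (9 + 2 log K)/K`, `K = (d−1)β ≥ 2`) as `w`, and the centre `−1 ∈ SU(2)`
(`Literature/Barriers/…/CenterSymmetryBreakingByQuarks.scalarCenter`).  Relative to the GEN-20 draft on
the one-plane count (`L^d/3`), the exponent is `d·L^d/4` — `L^4` in four dimensions.

## What is proved (all [ours])

* **`su2_kl_arHybrid_ge_dim_mul_card_site`** — `d ≥ 2`, `L ≥ 2`, `K = (d−1)β ≥ 2` with `9 + 2 log K ≤ K`;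
  ANY duplicate-free list of ALL links; squeezed conditionals normalised in their link and not reading
  later links, each `q_e` blind to the other links at an endpoint `Y e` of `e`:
  `(d·L^d/4)·(1 − (9 + 2 log K)/K)²/2 ≤ KL(e^{−βS_W}/Z ‖ H_l)`.
* **`su2_tauInt_sign_ge_exp_dim_mul_card_site`** — for every measurable balanced sign observable `g` of the
  exact independence sampler: `exp((d·L^d/4)·(1 − (9 + 2 log K)/K)²/2) − ½ ≤ τ_int(g)`.

READING (value-free): the tree's `β` multiplies `Σ_p (2 − Re tr U_p)`, i.e. `β = β_W/2`; in `d = 4`,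
`K = 3β`, and `9 + 2 log K ≤ K` holds from `K ≥ 18` (tree `β ≥ 6`, Wilson `β_W ≥ 12`), where the rate per
site is `(1 − (9 + 2 log K)/K)²/2 → ½` as `β → ∞`: `τ_int(sign) ≥ exp(L^4·(1 − (9 + 2log 3β)/(3β))²/2) − ½`.
NOT CLAIMED: anything for `K < 2`; the strong-coupling end (see
`Scaling/AutoregressiveGaugeKLExtensiveStrongCoupling` for `SU(n)` at `β ≤ β₁`); `SU(3)` explicit constants
(no explicit `SU(3)` small-ball bound in the tree yet).  No `def`, no `sorry`, nothing cited as a fact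
beyond the tree.
-/

noncomputable section

namespace Summit.Ventures.LatticeQCDFlow.Theory2.Autoregressive

open MeasureTheory Function Set
open Literature.MathematicalPhysics.QuantumFieldTheory Literature.MathematicalPhysics.QuantumLattice
open Summit.Ventures.LatticeQCDFlow.Exactness Summit.Ventures.LatticeQCDFlow.Scoring
open scoped Matrix Matrix.Norms.Frobenius

variable {d L : ℕ} [NeZero L]

set_option maxHeartbeats 400000 in
/-- **THE `SU(2)` VOLUME LAW FOR THE TRAINING LOSS, explicit constants, all orientations.**  `d ≥ 2`,
`L ≥ 2`, `K = (d−1)β ≥ 2` with `9 + 2 log K ≤ K`; `l` any duplicate-free list of ALL links; squeezed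
conditionals normalised in their link and not reading later links; every `q_e` blind to the other links at
an endpoint `Y e` of `e`.  Then `(d·L^d/4)·(1 − (9 + 2 log K)/K)²/2 ≤ KL(e^{−βS_W}/Z ‖ H_l)`. [ours] -/
theorem su2_kl_arHybrid_ge_dim_mul_card_site (hd : 2 ≤ d) (hL : 2 ≤ L) {β : ℝ}
    (hK : 2 ≤ ((d : ℝ) - 1) * β)
    (hK' : 9 + 2 * Real.log (((d : ℝ) - 1) * β) ≤ ((d : ℝ) - 1) * β)
    {q : Edge d L → GaugeConfig d L (Matrix.specialUnitaryGroup (Fin 2) ℂ) → ℝ}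
    (hqm : ∀ a, Measurable (q a)) {cq Cq : ℝ} (hcq : 0 < cq)
    (hqlo : ∀ a U, cq ≤ q a U) (hqhi : ∀ a U, q a U ≤ Cq)
    (hq1 : ∀ a U, ∫ v, q a (update U a v) ∂(haarProbability (Matrix.specialUnitaryGroup (Fin 2) ℂ)) = 1)
    (l : List (Edge d L)) (hl : l.Nodup) (hall : ∀ e : Edge d L, e ∈ l)
    (hpw : l.Pairwise (fun a b => ∀ (U : GaugeConfig d L (Matrix.specialUnitaryGroup (Fin 2) ℂ))
      (v : Matrix.specialUnitaryGroup (Fin 2) ℂ), q a (update U b v) = q a U))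
    (Y : Edge d L → Site d L) (hY : ∀ e : Edge d L, e.1 = Y e ∨ e.1.shift e.2 = Y e)
    (hqB : ∀ e e' : Edge d L, e'.1 = Y e ∨ e'.1.shift e'.2 = Y e → e' ≠ e →
      ∀ (U : GaugeConfig d L (Matrix.specialUnitaryGroup (Fin 2) ℂ)) (v : Matrix.specialUnitaryGroup (Fin 2) ℂ),
        q e (update U e' v) = q e U) :
    (d : ℝ) * (L : ℝ) ^ d / 4 * (1 - (9 + 2 * Real.log (((d : ℝ) - 1) * β)) / (((d : ℝ) - 1) * β)) ^ 2 / 2 ≤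
      ∫ U, Real.exp (-β * wilsonAction (fundamentalRep (Fin 2)) U) /
            (∫ W, Real.exp (-β * wilsonAction (fundamentalRep (Fin 2)) W)
              ∂Measure.pi (fun _ : Edge d L => haarProbability (Matrix.specialUnitaryGroup (Fin 2) ℂ))) *
          Real.log ((Real.exp (-β * wilsonAction (fundamentalRep (Fin 2)) U) /
              ∫ W, Real.exp (-β * wilsonAction (fundamentalRep (Fin 2)) W)
                ∂Measure.pi (fun _ : Edge d L => haarProbability (Matrix.specialUnitaryGroup (Fin 2) ℂ))) /
            ((l.map fun b => q b U).prod *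
                coordAvg (haarProbability (Matrix.specialUnitaryGroup (Fin 2) ℂ)) l.toFinset
                  (fun V : GaugeConfig d L (Matrix.specialUnitaryGroup (Fin 2) ℂ) =>
                    Real.exp (-β * wilsonAction (fundamentalRep (Fin 2)) V)) U /
              ∫ W, Real.exp (-β * wilsonAction (fundamentalRep (Fin 2)) W)
                ∂Measure.pi (fun _ : Edge d L => haarProbability (Matrix.specialUnitaryGroup (Fin 2) ℂ))))
        ∂Measure.pi (fun _ : Edge d L => haarProbability (Matrix.specialUnitaryGroup (Fin 2) ℂ)) := by
  haveI : SecondCountableTopology (Matrix (Fin 2) (Fin 2) ℂ) :=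
    inferInstanceAs (SecondCountableTopology (Fin 2 → Fin 2 → ℂ))
  haveI : SecondCountableTopology (Matrix.specialUnitaryGroup (Fin 2) ℂ) :=
    Topology.IsEmbedding.subtypeVal.secondCountableTopology
  have hd1 : (0 : ℝ) < (d : ℝ) - 1 := by
    have : (2 : ℝ) ≤ d := by exact_mod_cast hd
    linarith
  have hβ : 0 < β := by
    by_contra h
    have : ((d : ℝ) - 1) * β ≤ 0 := mul_nonpos_of_nonneg_of_nonpos hd1.le (not_lt.1 h)
    linarith
  have hKpos : 0 < ((d : ℝ) - 1) * β := by linarith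
  -- the central element `−1 ∈ SU(2)` acts by `−1 ≠ 1`, `‖−1‖ = 1`
  have hω : fundamentalRep (Fin 2)
      (Literature.Barriers.QuantumFields.scalarCenter 2 (-1) (by norm_num) (by norm_num)) =
      (-1 : ℂ) • (1 : Matrix (Fin 2) (Fin 2) ℂ) := rfl
  have hne : (-1 : ℂ) ≠ 1 := by norm_num
  -- the explicit floor is a common lower bound of all plaquette means, and is non-negative
  have hw0 : 0 ≤ 1 - (9 + 2 * Real.log (((d : ℝ) - 1) * β)) / (((d : ℝ) - 1) * β) := by
    rw [sub_nonneg, div_le_one hKpos]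
    exact hK'
  have hw : ∀ p : Plaquette d L, 1 - (9 + 2 * Real.log (((d : ℝ) - 1) * β)) / (((d : ℝ) - 1) * β) ≤
      wilsonExpectation (fundamentalRep (Fin 2)) β
        (fun U : GaugeConfig d L (Matrix.specialUnitaryGroup (Fin 2) ℂ) =>
          ((2 : ℕ) : ℝ)⁻¹ * (fundamentalRep (Fin 2) (plaquetteHolonomy U p.1 p.2.1.1 p.2.1.2)).trace.re) :=
    fun p => wilsonExpectation_plaquette_ge_su2 hd hK p.1 (ne_of_lt p.2.2)
  have hmain := wilson_kl_arHybrid_ge_dim_mul_card_site_div_four_mul_sq (d := d) (L := L) (fundamentalRep (Fin 2))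
    hd (continuous_fundamentalRep (Fin 2)) hL hω hne hw0 hw hqm hcq hqlo hqhi hq1 l hl hall hpw Y hY hqB
  have hcardSite : Fintype.card (Site d L) = L ^ d := by simp [Site, ZMod.card]
  rw [hcardSite] at hmain
  push_cast at hmain
  exact hmain

set_option maxHeartbeats 400000 in
/-- **THE `SU(2)` EXPONENTIAL SLOWING DOWN, explicit constants, all orientations.**  Under the hypotheses of
`su2_kl_arHybrid_ge_dim_mul_card_site`, for every measurable balanced sign observable `g` (`g² = 1`,
`∫ g e^{−βS_W} dπ = 0`) of the exact independence sampler with target `e^{−βS_W}/Z` and the autoregressive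
proposal: `exp((d·L^d/4)·(1 − (9 + 2 log K)/K)²/2) − ½ ≤ τ_int(g)`. [ours] -/
theorem su2_tauInt_sign_ge_exp_dim_mul_card_site (hd : 2 ≤ d) (hL : 2 ≤ L) {β : ℝ}
    (hK : 2 ≤ ((d : ℝ) - 1) * β)
    (hK' : 9 + 2 * Real.log (((d : ℝ) - 1) * β) ≤ ((d : ℝ) - 1) * β)
    {q : Edge d L → GaugeConfig d L (Matrix.specialUnitaryGroup (Fin 2) ℂ) → ℝ}
    (hqm : ∀ a, Measurable (q a)) {cq Cq : ℝ} (hcq : 0 < cq)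
    (hqlo : ∀ a U, cq ≤ q a U) (hqhi : ∀ a U, q a U ≤ Cq)
    (hq1 : ∀ a U, ∫ v, q a (update U a v) ∂(haarProbability (Matrix.specialUnitaryGroup (Fin 2) ℂ)) = 1)
    (l : List (Edge d L)) (hl : l.Nodup) (hall : ∀ e : Edge d L, e ∈ l)
    (hpw : l.Pairwise (fun a b => ∀ (U : GaugeConfig d L (Matrix.specialUnitaryGroup (Fin 2) ℂ))
      (v : Matrix.specialUnitaryGroup (Fin 2) ℂ), q a (update U b v) = q a U))
    (Y : Edge d L → Site d L) (hY : ∀ e : Edge d L, e.1 = Y e ∨ e.1.shift e.2 = Y e)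
    (hqB : ∀ e e' : Edge d L, e'.1 = Y e ∨ e'.1.shift e'.2 = Y e → e' ≠ e →
      ∀ (U : GaugeConfig d L (Matrix.specialUnitaryGroup (Fin 2) ℂ)) (v : Matrix.specialUnitaryGroup (Fin 2) ℂ),
        q e (update U e' v) = q e U)
    {g : GaugeConfig d L (Matrix.specialUnitaryGroup (Fin 2) ℂ) → ℝ} (hgm : Measurable g)
    (hg1 : ∀ U, g U ^ 2 = 1)
    (hg0 : ∫ U, g U * Real.exp (-β * wilsonAction (fundamentalRep (Fin 2)) U)
      ∂Measure.pi (fun _ : Edge d L => haarProbability (Matrix.specialUnitaryGroup (Fin 2) ℂ)) = 0) :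
    Real.exp ((d : ℝ) * (L : ℝ) ^ d / 4 *
        (1 - (9 + 2 * Real.log (((d : ℝ) - 1) * β)) / (((d : ℝ) - 1) * β)) ^ 2 / 2) - 1 / 2 ≤
      tauInt (fun k => (∫ U, g U *
          ((imhOp (Measure.pi fun _ : Edge d L => haarProbability (Matrix.specialUnitaryGroup (Fin 2) ℂ))
            (fun V : GaugeConfig d L (Matrix.specialUnitaryGroup (Fin 2) ℂ) =>
              Real.exp (-β * wilsonAction (fundamentalRep (Fin 2)) V))
            (fun V : GaugeConfig d L (Matrix.specialUnitaryGroup (Fin 2) ℂ) => (l.map fun b => q b V).prod *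
                coordAvg (haarProbability (Matrix.specialUnitaryGroup (Fin 2) ℂ)) l.toFinset
                  (fun V' : GaugeConfig d L (Matrix.specialUnitaryGroup (Fin 2) ℂ) =>
                    Real.exp (-β * wilsonAction (fundamentalRep (Fin 2)) V')) V /
              ∫ W, Real.exp (-β * wilsonAction (fundamentalRep (Fin 2)) W)
                ∂Measure.pi (fun _ : Edge d L => haarProbability (Matrix.specialUnitaryGroup (Fin 2) ℂ))))^[k]
            g) U * Real.exp (-β * wilsonAction (fundamentalRep (Fin 2)) U)
          ∂Measure.pi (fun _ : Edge d L => haarProbability (Matrix.specialUnitaryGroup (Fin 2) ℂ))) /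
          ∫ U, g U ^ 2 * Real.exp (-β * wilsonAction (fundamentalRep (Fin 2)) U)
            ∂Measure.pi (fun _ : Edge d L => haarProbability (Matrix.specialUnitaryGroup (Fin 2) ℂ))) := by
  haveI : SecondCountableTopology (Matrix (Fin 2) (Fin 2) ℂ) :=
    inferInstanceAs (SecondCountableTopology (Fin 2 → Fin 2 → ℂ))
  haveI : SecondCountableTopology (Matrix.specialUnitaryGroup (Fin 2) ℂ) :=
    Topology.IsEmbedding.subtypeVal.secondCountableTopology
  have hd1 : (0 : ℝ) < (d : ℝ) - 1 := by
    have : (2 : ℝ) ≤ d := by exact_mod_cast hd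
    linarith
  have hβ : 0 < β := by
    by_contra h
    have : ((d : ℝ) - 1) * β ≤ 0 := mul_nonpos_of_nonneg_of_nonpos hd1.le (not_lt.1 h)
    linarith
  have hKpos : 0 < ((d : ℝ) - 1) * β := by linarith
  -- the central element `−1 ∈ SU(2)` acts by `−1 ≠ 1`, `‖−1‖ = 1`
  have hω : fundamentalRep (Fin 2)
      (Literature.Barriers.QuantumFields.scalarCenter 2 (-1) (by norm_num) (by norm_num)) =
      (-1 : ℂ) • (1 : Matrix (Fin 2) (Fin 2) ℂ) := rfl
  have hne : (-1 : ℂ) ≠ 1 := by norm_num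
  -- the explicit floor is a common lower bound of all plaquette means, and is non-negative
  have hw0 : 0 ≤ 1 - (9 + 2 * Real.log (((d : ℝ) - 1) * β)) / (((d : ℝ) - 1) * β) := by
    rw [sub_nonneg, div_le_one hKpos]
    exact hK'
  have hw : ∀ p : Plaquette d L, 1 - (9 + 2 * Real.log (((d : ℝ) - 1) * β)) / (((d : ℝ) - 1) * β) ≤
      wilsonExpectation (fundamentalRep (Fin 2)) β
        (fun U : GaugeConfig d L (Matrix.specialUnitaryGroup (Fin 2) ℂ) =>
          ((2 : ℕ) : ℝ)⁻¹ * (fundamentalRep (Fin 2) (plaquetteHolonomy U p.1 p.2.1.1 p.2.1.2)).trace.re) :=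
    fun p => wilsonExpectation_plaquette_ge_su2 hd hK p.1 (ne_of_lt p.2.2)
  have hmain := wilson_tauInt_sign_ge_exp_dim_mul_card_site_div_four_mul_sq (d := d) (L := L)
    (fundamentalRep (Fin 2)) hd (continuous_fundamentalRep (Fin 2)) hL hω hne hw0 hw hqm hcq hqlo hqhi
    hq1 l hl hall hpw Y hY hqB hgm hg1 hg0
  have hcardSite : Fintype.card (Site d L) = L ^ d := by simp [Site, ZMod.card]
  rw [hcardSite] at hmain
  push_cast at hmain
  exact hmain

end Summit.Ventures.LatticeQCDFlow.Theory2.Autoregressive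

end
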